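import Mathlib
import HarnessLib
import Literature.Analysis.FluidPDE.HarmonicAnalyticContinuation
import Summits.NavierStokesRegularity.NavierStokesRegularity.Theorems.LocalHelicityTubeDoorFrobeniusProfileRigidityBernoulli
import Summits.NavierStokesRegularity.NavierStokesRegularity.Theorems.LocalHelicityTubeDoorFrobeniusWindowRigidityWindow

/-!
# Door S11 `LocalTubeDoorHelicity`, crux K2⁗ `FrobeniusProfileRigidity` (stmt-NavierStokesRegularity-19975) — the
# Bernoulli stratum, WINDOW form: `⟪v, ∂ₜv − Δv⟫` vanishing on a window of every slice ⇒ not backward-singular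

Cell ns-regularity-ideate, stub-worker `ns-helicity-19975-w1` under the K2⁗ lead nsreg-p6 (lands
`--supports stmt-NavierStokesRegularity-19975 --as helper`; no claim).  Sequel of
`…FrobeniusProfileRigidityBernoulli` (`eq_zero_of_bernoulli`: a profile of the Type-I class with `⟪v, ∂ₜv⟫ = ⟪v, Δv⟫`
— Bernoulli head constant along streamlines — on every slice vanishes identically), in the shape of a door's profile
crux (cf. `…EnstrophyProductionProfileRigidity.productionWindowRigidity`):

* `analyticOnNhd_timeDeriv_slice` — the time derivative `y ↦ ∂ₜv(s, y)` of a slice of an Oseen-ancient field is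
  real-analytic on `ℝ³` (joint analyticity `analyticOnNhd_uncurry`, `AnalyticOnNhd.fderiv`, chain rule
  `∂ₜv(s,y) = D(uncurry v)(s,y)[(1,0)]`);
* `analyticOnNhd_bernoulliScalar_slice` — hence the BERNOULLI SCALAR `y ↦ ⟪v(s,y), ∂ₜv(s,y)⟫ − ⟪v(s,y), Δv(s)(y)⟫`
  (`= −v·∇(p + |v|²/2)` for any classical pressure) is real-analytic on every slice;
* `bernoulliWindowToSlab` — its vanishing on a nonempty open window of every slice spreads to the slice
  (`real_eq_zero_spread`);
* `bernoulliWindowRigidity` — **a profile of the Type-I class whose Bernoulli scalar vanishes on a nonempty open window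
  of every slice `s < 0` is not backward-singular at the apex** (indeed `≡ 0`, `eq_zero_of_bernoulli_window`).

So at a locally Type-I singular point the streamline derivative of the Bernoulli head cannot fade on any similarity
window of the blow-up profile — the profile side of a would-be «Bernoulli-work door» for the planners (window scalar
`u·∇(p + |u|²/2) = −⟪u, ∂ₜu − νΔu⟫`, scale-normalised); the zoom/K1 side is NOT supplied here.

WHAT THIS IS NOT: not a claim about Navier–Stokes regularity, not K2⁗ — the window form of one settled stratum of the
Type-I profile class (bears_on LADDER-NS N0, door S11 support).
-/

noncomputable section

-- the summit and its single sub-problem share the name (CONVENTIONS §1), as in every Theorems file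
set_option linter.dupNamespace false

namespace Summit.NavierStokesRegularity.NavierStokesRegularity.Theorems.LocalHelicityTubeDoorFrobeniusProfileRigidityBernoulliWindow

open MeasureTheory Set Function Filter Topology TopologicalSpace Metric InnerProductSpace
open scoped RealInnerProductSpace InnerProductSpace Laplacian ContDiff
open Literature.Analysis Literature.Analysis.FluidPDE
open Summit.NavierStokesRegularity.NavierStokesRegularity.Theorems.LocalSineTubeDoorProfileAlignedWindowRigidityAncient
open Summit.NavierStokesRegularity.NavierStokesRegularity.Theorems.PoloidalWindowDoorPoloidalWindowRigidityFlat
open Summit.NavierStokesRegularity.NavierStokesRegularity.Theorems.LocalHelicityTubeDoorFrobeniusWindowRigidityWindow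
open Summit.NavierStokesRegularity.NavierStokesRegularity.Theorems.LocalHelicityTubeDoorFrobeniusProfileRigidityBernoulli

variable {C : ℝ} {v : ℝ → EuclideanSpace ℝ (Fin 3) → EuclideanSpace ℝ (Fin 3)}

/-! ### slice analyticity of the time derivative and of the Bernoulli scalar -/

/-- **The time derivative of a slice is real-analytic.**  For an Oseen-ancient field (continuity on the open slab,
boundedness below every `−δ`, unit-viscosity Oseen–Duhamel identity) and `s < 0`, the map `y ↦ ∂ₜv(s, y)` (two-sided
derivative of `τ ↦ v(τ, y)` at `s`) is real-analytic on `ℝ³`: it is `y ↦ D(uncurry v)(s, y)[(1, 0)]`, an evaluation of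
the analytic derivative of the jointly analytic field. -/
theorem analyticOnNhd_timeDeriv_slice (hcont : ContinuousOn (uncurry v) (Iio (0 : ℝ) ×ˢ univ))
    (hbdd : ∀ δ : ℝ, 0 < δ → ∃ B : ℝ, ∀ t < -δ, ∀ y : EuclideanSpace ℝ (Fin 3), ‖v t y‖ ≤ B)
    (hmild : ∀ s t : ℝ, s < t → t < 0 → ∀ y : EuclideanSpace ℝ (Fin 3),
      v t y = UnboundedOperators.heatExtension (v s) (t - s) y - oseenDuhamel 1 s v v t y)
    {s : ℝ} (hs : s < 0) :
    AnalyticOnNhd ℝ (fun y => deriv (fun τ => v τ y) s) univ := by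
  have hA : AnalyticOnNhd ℝ (uncurry v) (Iio (0 : ℝ) ×ˢ univ) := analyticOnNhd_uncurry hcont hbdd hmild
  have hD : AnalyticOnNhd ℝ (fderiv ℝ (uncurry v)) (Iio (0 : ℝ) ×ˢ univ) := hA.fderiv
  have hsy : ∀ y : EuclideanSpace ℝ (Fin 3), (s, y) ∈ Iio (0 : ℝ) ×ˢ (univ : Set (EuclideanSpace ℝ (Fin 3))) :=
    fun y => mem_prod.2 ⟨hs, mem_univ _⟩
  -- `y ↦ D(uncurry v)(s, y)` and its evaluation at `(1, 0)` are analytic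
  have hD1 : AnalyticOnNhd ℝ (fun y : EuclideanSpace ℝ (Fin 3) => fderiv ℝ (uncurry v) (s, y)) univ := by
    intro y _
    exact (hD (s, y) (hsy y)).comp (analyticAt_const.prod analyticAt_id)
  have hD2 : AnalyticOnNhd ℝ
      (fun y : EuclideanSpace ℝ (Fin 3) => fderiv ℝ (uncurry v) (s, y) ((1 : ℝ), (0 : EuclideanSpace ℝ (Fin 3)))) univ :=
    (ContinuousLinearMap.apply ℝ (EuclideanSpace ℝ (Fin 3)) ((1 : ℝ), (0 : EuclideanSpace ℝ (Fin 3)))).comp_analyticOnNhd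
      hD1
  -- the chain rule identifies the evaluation with the time derivative
  refine fun y hy => (hD2 y hy).congr (Filter.Eventually.of_forall fun y' => ?_)
  have hd : HasFDerivAt (uncurry v) (fderiv ℝ (uncurry v) (s, y')) (s, y') :=
    ((hA (s, y') (hsy y')).differentiableAt).hasFDerivAt
  have hι : HasDerivAt (fun τ : ℝ => ((τ, y') : ℝ × EuclideanSpace ℝ (Fin 3)))
      ((1 : ℝ), (0 : EuclideanSpace ℝ (Fin 3))) s :=
    (hasDerivAt_id s).prodMk (hasDerivAt_const s y')
  have h3 : HasDerivAt (uncurry v ∘ fun τ : ℝ => ((τ, y') : ℝ × EuclideanSpace ℝ (Fin 3)))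
      (fderiv ℝ (uncurry v) (s, y') ((1 : ℝ), (0 : EuclideanSpace ℝ (Fin 3)))) s :=
    hd.comp_hasDerivAt s hι
  have h4 : (uncurry v ∘ fun τ : ℝ => ((τ, y') : ℝ × EuclideanSpace ℝ (Fin 3))) = fun τ => v τ y' := rfl
  rw [h4] at h3
  exact h3.deriv.symm

/-- **The Bernoulli scalar of a slice is real-analytic**: for a profile of the Type-I class and `s < 0`,
`y ↦ ⟪v(s,y), ∂ₜv(s,y)⟫ − ⟪v(s,y), Δv(s)(y)⟫` is real-analytic on `ℝ³` (slice analyticity, `analyticOnNhd_timeDeriv_slice`,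
`analyticOnNhd_laplacian`, `analyticOnNhd_inner`). -/
theorem analyticOnNhd_bernoulliScalar_slice (hrate : HasTypeITimeDecay C v)
    (hcont : ContinuousOn (uncurry v) (Iio (0 : ℝ) ×ˢ univ))
    (hmild : ∀ s t : ℝ, s < t → t < 0 → ∀ x,
      v t x = UnboundedOperators.heatExtension (v s) (t - s) x - oseenDuhamel 1 s v v t x)
    {s : ℝ} (hs : s < 0) :
    AnalyticOnNhd ℝ (fun y => ⟪v s y, deriv (fun τ => v τ y) s⟫_ℝ - ⟪v s y, (Δ (v s)) y⟫_ℝ) univ := by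
  have hsl : AnalyticOnNhd ℝ (v s) univ := analyticOnNhd_slice hcont (bdd_of_hasTypeITimeDecay hrate) hmild hs
  have hdt := analyticOnNhd_timeDeriv_slice hcont (bdd_of_hasTypeITimeDecay hrate) hmild hs
  have hlap : AnalyticOnNhd ℝ (Δ (v s)) univ := analyticOnNhd_laplacian hsl
  exact (analyticOnNhd_inner hsl hdt).sub (analyticOnNhd_inner hsl hlap)

/-! ### window → slab, and the window crux shape -/

/-- **Window → slab for the Bernoulli scalar**: if on every slice `s < 0` the identity `⟪v, ∂ₜv⟫ = ⟪v, Δv⟫` holds on a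
nonempty open window, it holds on the whole slice (identity theorem for the real-analytic Bernoulli scalar). -/
theorem bernoulliWindowToSlab (hrate : HasTypeITimeDecay C v)
    (hcont : ContinuousOn (uncurry v) (Iio (0 : ℝ) ×ˢ univ))
    (hmild : ∀ s t : ℝ, s < t → t < 0 → ∀ x,
      v t x = UnboundedOperators.heatExtension (v s) (t - s) x - oseenDuhamel 1 s v v t x)
    (hwin : ∀ s < 0, ∃ U : Set (EuclideanSpace ℝ (Fin 3)), IsOpen U ∧ U.Nonempty ∧
      ∀ y ∈ U, ⟪v s y, deriv (fun τ => v τ y) s⟫_ℝ = ⟪v s y, (Δ (v s)) y⟫_ℝ) :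
    ∀ s < 0, ∀ y, ⟪v s y, deriv (fun τ => v τ y) s⟫_ℝ = ⟪v s y, (Δ (v s)) y⟫_ℝ := by
  intro s hs y
  obtain ⟨U, hU, hne, hal⟩ := hwin s hs
  have h := real_eq_zero_spread (analyticOnNhd_bernoulliScalar_slice hrate hcont hmild hs) hU hne
    (fun y hy => sub_eq_zero.2 (hal y hy)) y
  exact sub_eq_zero.1 h

/-- **Bernoulli on a window of every slice ⇒ the profile vanishes identically.** -/
theorem eq_zero_of_bernoulli_window (hrate : HasTypeITimeDecay C v)
    (hcont : ContinuousOn (uncurry v) (Iio (0 : ℝ) ×ˢ univ))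
    (hmild : ∀ s t : ℝ, s < t → t < 0 → ∀ x,
      v t x = UnboundedOperators.heatExtension (v s) (t - s) x - oseenDuhamel 1 s v v t x)
    (hdiv : ∀ t < 0, VectorCalculus.IsDivFree (v t))
    (hwin : ∀ s < 0, ∃ U : Set (EuclideanSpace ℝ (Fin 3)), IsOpen U ∧ U.Nonempty ∧
      ∀ y ∈ U, ⟪v s y, deriv (fun τ => v τ y) s⟫_ℝ = ⟪v s y, (Δ (v s)) y⟫_ℝ) :
    ∀ t < 0, ∀ x, v t x = 0 :=
  eq_zero_of_bernoulli hrate hcont hmild hdiv (bernoulliWindowToSlab hrate hcont hmild hwin)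

/-- **THE WINDOW FORM OF THE BERNOULLI STRATUM (door-crux shape).**  A profile of the Type-I class (rate, continuity
on the open slab, unit-viscosity Oseen–Duhamel identity, divergence-free slices) whose Bernoulli scalar
`⟪v, ∂ₜv⟫ − ⟪v, Δv⟫` (`= −v·∇(p + |v|²/2)` for any classical pressure) vanishes on a nonempty open window of every
slice `s < 0` is not backward-singular at the apex. -/
theorem bernoulliWindowRigidity :
    ∀ (C : ℝ) (v : ℝ → EuclideanSpace ℝ (Fin 3) → EuclideanSpace ℝ (Fin 3)),
      Literature.Analysis.FluidPDE.HasTypeITimeDecay C v →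
      ContinuousOn (Function.uncurry v) (Set.Iio (0 : ℝ) ×ˢ Set.univ) →
      (∀ s t : ℝ, s < t → t < 0 → ∀ x, v t x =
        Literature.Analysis.UnboundedOperators.heatExtension (v s) (t - s) x -
          Literature.Analysis.FluidPDE.oseenDuhamel 1 s v v t x) →
      (∀ t < 0, Literature.Analysis.FluidPDE.VectorCalculus.IsDivFree (v t)) →
      (∀ s < 0, ∃ U : Set (EuclideanSpace ℝ (Fin 3)), IsOpen U ∧ U.Nonempty ∧
        ∀ y ∈ U, ⟪v s y, deriv (fun τ => v τ y) s⟫_ℝ = ⟪v s y, (Δ (v s)) y⟫_ℝ) →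
      ¬ Literature.Analysis.FluidPDE.IsBackwardSingularPoint v 0 := by
  intro C v hrate hcont hmild hdiv hwin
  exact not_backwardSingular_of_zero (eq_zero_of_bernoulli_window hrate hcont hmild hdiv hwin)

end Summit.NavierStokesRegularity.NavierStokesRegularity.Theorems.LocalHelicityTubeDoorFrobeniusProfileRigidityBernoulliWindow

end
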